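import Summits.QuantumFields.YangMills.Theorems.PoincareLipschitzOrbitMinimiserCoulomb
import HarnessLib

/-!
# Crux stmt-QuantumFields-19936 `UnitScaleTilt.HistoryTailL`, K2 at depth (route crux `PoincareLipschitz.BlockLipschitzL`, stmt-QuantumFields-23533):
# ONE-SITE OPTIMALITY OF A BOX-ℓ²-ORBIT MINIMISER IN CLOSED FORM — the site matrix `M_x` is a NON-NEGATIVE REAL SCALAR

✓`PoincareLipschitzOrbitMinCoulomb.re_trace_su_mul_siteSum_eq_zero_of_orbitMin` (this seat, p681590) says that at a pair `(U, U')` of level-zero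
`SU(2)` fields in which `U'` is a box-`ℓ²`-closest point of its gauge orbit to `U`, the site matrix
`M_x = Σ_{b∈box, b₋=x} U'_bU_b⁻¹ + Σ_{b∈box, b₊=x} U'_b⁻¹U_b ∈ M₂(ℂ)` satisfies `Re tr(X·M_x) = 0` for every `X ∈ 𝔰𝔲(2)`.  This file turns that family of
equations into ONE matrix identity, the form a supplier actually uses:

* §1 the quaternionic letters of `M₂(ℂ)`: `SU(2) ⊂ ℍ := {A : A + Aᴴ = (tr A)·1}` (✓`MatrixNorms.add_conjTranspose_of_mem_specialUnitaryGroup_two`,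
  Cayley–Hamilton), `ℍ` is closed under the guarded sums defining `M_x`, and `tr` is real on `ℍ`;
* §2 `eq_smul_one_of_quat_of_forall_re_trace` — for `A ∈ ℍ`, `Re tr(X·A) = 0 ∀ X ∈ 𝔰𝔲(2)` forces `A = (Re tr A / 2)·1`: the test element
  `X := A − (tr A/2)·1` lies in `𝔰𝔲(2)` and gives `Re tr(X·A) = Re tr(X²) = −tr(XᴴX) = −Σ|X_ij|²`, so `X = 0`
  (`Matrix.trace_conjTranspose_mul_self_eq_zero_iff`);
* §3 ★★ `siteSum_eq_smul_one_of_orbitMin` — at a box-`ℓ²`-orbit minimiser, for EVERY site `x`: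
  `M_x = (Re tr M_x / 2)·1` and `0 ≤ Re tr M_x` (the latter from the competitor `g = −1` in ✓`reTr_oneSite_le_of_orbitMin`).  Since conversely
  `Re tr(g·m·1) = m·Re tr g ≤ 2m` for `m ≥ 0`, this IS one-site optimality: the perturbation `W_b = U'_bU_b⁻¹` has, at every site, outgoing values and
  back-transported inverse incoming values summing to a non-negative multiple of the identity — its quaternionic imaginary (𝔰𝔲(2)) parts cancel
  exactly (covariant Coulomb condition) and its real parts add up non-negatively.

WHAT THIS IS NOT: nothing here proves the restricted row of ✓`avgStabilityModGauge_of_orbitMinimising`, `stub_iteratedLipschitz`, the crux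
`BlockLipschitzL`, the crux `HistoryTailL`, rung R3 (YM₃ on T³ — not d = 4, not infinite volume, not a mass gap, not the Clay problem) or a summit
statement.  Width seat ym-ust-19936-w5 g10 (cell ym3-torus), `--supports stmt-QuantumFields-19936`.
-/

noncomputable section

open scoped BigOperators Matrix.Norms.L2Operator Matrix ComplexOrder

namespace Summit.QuantumFields.YangMills.Theorems.PoincareLipschitzOrbitMinScalar

open Literature.MathematicalPhysics.QuantumFieldTheory.Balaban1983to89
open Summit.QuantumFields.YangMills.Theorems.PoincareLipschitzOrbitMinCoulomb
  (reTr_oneSite_le_of_orbitMin re_trace_su_mul_siteSum_eq_zero_of_orbitMin reTr_eq_half_re_trace)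

/-! ## §1 Quaternionic letters: `ℍ = {A ∈ M₂(ℂ) : A + Aᴴ = (tr A)·1}` -/

section Quat

/-- `ℍ` is closed under addition. [folklore] -/
theorem quat_add {A B : Matrix (Fin 2) (Fin 2) ℂ} (hA : A + Aᴴ = A.trace • (1 : Matrix (Fin 2) (Fin 2) ℂ))
    (hB : B + Bᴴ = B.trace • (1 : Matrix (Fin 2) (Fin 2) ℂ)) :
    (A + B) + (A + B)ᴴ = (A + B).trace • (1 : Matrix (Fin 2) (Fin 2) ℂ) := by
  rw [Matrix.conjTranspose_add, Matrix.trace_add, add_smul, ← hA, ← hB]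
  abel

/-- The guarded site sums defining `M_x` stay in `ℍ`. [folklore] -/
theorem quat_sum_ite {ι : Type*} (s : Finset ι) (c : ι → Prop) [DecidablePred c] (W : ι → Matrix (Fin 2) (Fin 2) ℂ)
    (hW : ∀ i ∈ s, c i → W i + (W i)ᴴ = (W i).trace • (1 : Matrix (Fin 2) (Fin 2) ℂ)) :
    (∑ i ∈ s, if c i then W i else 0) + (∑ i ∈ s, if c i then W i else 0)ᴴ =
      (∑ i ∈ s, if c i then W i else 0).trace • (1 : Matrix (Fin 2) (Fin 2) ℂ) := by
  refine Finset.sum_induction _ (fun A : Matrix (Fin 2) (Fin 2) ℂ => A + Aᴴ = A.trace • (1 : Matrix (Fin 2) (Fin 2) ℂ))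
    (fun A B hA hB => quat_add hA hB) (by simp) ?_
  intro i hi
  by_cases hc : c i
  · rw [if_pos hc]; exact hW i hi hc
  · rw [if_neg hc]; simp

/-- `tr` is real on `ℍ`: `star (tr A) = tr A`. [folklore] -/
theorem star_trace_eq_of_quat {A : Matrix (Fin 2) (Fin 2) ℂ} (hA : A + Aᴴ = A.trace • (1 : Matrix (Fin 2) (Fin 2) ℂ)) :
    star A.trace = A.trace := by
  have h := congrArg Matrix.trace hA
  rw [Matrix.trace_add, Matrix.trace_conjTranspose, Matrix.trace_smul, Matrix.trace_one, Fintype.card_fin, smul_eq_mul] at h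
  have h2 : star A.trace = A.trace * (2 : ℕ) - A.trace := eq_sub_of_add_eq' h
  rw [h2]
  push_cast
  ring

/-- `SU(2) ⊂ ℍ` (Cayley–Hamilton with `det = 1`). [cite: Balaban1987RG1, (0.14) p.254] -/
theorem quat_coe_su2 (V : Matrix.specialUnitaryGroup (Fin 2) ℂ) :
    (V : Matrix (Fin 2) (Fin 2) ℂ) + (V : Matrix (Fin 2) (Fin 2) ℂ)ᴴ = (V : Matrix (Fin 2) (Fin 2) ℂ).trace • (1 : Matrix (Fin 2) (Fin 2) ℂ) :=
  MatrixNorms.add_conjTranspose_of_mem_specialUnitaryGroup_two V.2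

end Quat

/-! ## §2 On `ℍ`, `Re tr(X·A) = 0` for all `X ∈ 𝔰𝔲(2)` forces `A` to be a real scalar -/

section Scalar

/-- **A QUATERNION ORTHOGONAL TO `𝔰𝔲(2)` IS REAL**: if `A + Aᴴ = (tr A)·1` and `Re tr(X·A) = 0` for every skew-Hermitian trace-free `X`, then
`A = (Re tr A / 2)·1` (test with `X := A − (tr A/2)·1 ∈ 𝔰𝔲(2)`: `Re tr(X·A) = Re tr(X²) = −tr(XᴴX)`). [folklore] -/
theorem eq_smul_one_of_quat_of_forall_re_trace {A : Matrix (Fin 2) (Fin 2) ℂ} (hA : A + Aᴴ = A.trace • (1 : Matrix (Fin 2) (Fin 2) ℂ))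
    (h : ∀ X : Matrix (Fin 2) (Fin 2) ℂ, X ∈ skewAdjoint (Matrix (Fin 2) (Fin 2) ℂ) → X.trace = 0 → ((X * A).trace).re = 0) :
    A = (((A.trace).re / 2 : ℝ) : ℂ) • (1 : Matrix (Fin 2) (Fin 2) ℂ) := by
  set c : ℂ := A.trace / 2 with hc
  have hreal : star A.trace = A.trace := star_trace_eq_of_quat hA
  have hcstar : star c = c := by
    rw [hc, star_div₀, hreal]
    norm_num
  have hAH : Aᴴ = A.trace • (1 : Matrix (Fin 2) (Fin 2) ℂ) - A := eq_sub_of_add_eq' hA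
  set X : Matrix (Fin 2) (Fin 2) ℂ := A - c • 1 with hX
  -- `X ∈ 𝔰𝔲(2)`
  have hXstar : Xᴴ = -X := by
    rw [hX, Matrix.conjTranspose_sub, Matrix.conjTranspose_smul, Matrix.conjTranspose_one, hAH, hcstar, hc]
    ext i j
    simp [Matrix.sub_apply, Matrix.smul_apply, Matrix.one_apply]
    split_ifs <;> ring
  have hXmem : X ∈ skewAdjoint (Matrix (Fin 2) (Fin 2) ℂ) := by
    rw [skewAdjoint.mem_iff, Matrix.star_eq_conjTranspose, hXstar]
  have hXtr : X.trace = 0 := by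
    rw [hX, Matrix.trace_sub, Matrix.trace_smul, Matrix.trace_one, Fintype.card_fin, hc, smul_eq_mul]
    push_cast
    ring
  -- `Re tr(X·A) = Re tr(X·X) = −Re tr(Xᴴ X)`
  have h0 := h X hXmem hXtr
  have hXA : X * A = X * X + c • X := by
    have : A = X + c • 1 := by rw [hX]; abel
    conv_lhs => rw [this]
    rw [mul_add, Matrix.mul_smul, mul_one]
  rw [hXA, Matrix.trace_add, Matrix.trace_smul, hXtr, smul_zero, add_zero] at h0
  have hXX : X * X = -(Xᴴ * X) := by rw [hXstar, neg_mul, neg_neg]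
  rw [hXX, Matrix.trace_neg, Complex.neg_re, neg_eq_zero] at h0
  -- `tr(Xᴴ X) ≥ 0` is real, so it vanishes, so `X = 0`
  have hnn : 0 ≤ (Xᴴ * X).trace := (Matrix.posSemidef_conjTranspose_mul_self X).trace_nonneg
  have him : ((Xᴴ * X).trace).im = 0 := by
    have := (Complex.nonneg_iff.1 hnn).2
    simpa [eq_comm] using this
  have hzero : (Xᴴ * X).trace = 0 := Complex.ext (by simpa using h0) (by simpa using him)
  have hX0 : X = 0 := Matrix.trace_conjTranspose_mul_self_eq_zero_iff.1 hzero
  -- conclude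
  have hAc : A = c • 1 := by
    have : A - c • 1 = 0 := by rw [← hX]; exact hX0
    exact sub_eq_zero.1 this
  have hcre : c = (((A.trace).re / 2 : ℝ) : ℂ) := by
    have htr : A.trace = ((A.trace).re : ℂ) := by
      rw [Complex.star_def] at hreal
      exact (Complex.conj_eq_iff_re.1 hreal).symm
    rw [hc, htr]
    push_cast
    simp
  rw [← hcre]
  exact hAc

end Scalar

/-! ## §3 One-site optimality of a box-ℓ²-orbit minimiser, closed form -/

section Site

variable {P : Params}

/-- ★★ **AT A BOX-ℓ²-ORBIT MINIMISER EVERY SITE MATRIX IS A NON-NEGATIVE REAL SCALAR.**  If `U'` is a box-`ℓ²`-closest point of its level-zero gauge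
orbit to `U` (`∀ k, Σ_box dist1(U_b U'_b⁻¹)² ≤ Σ_box dist1(U_b((U'^k)_b)⁻¹)²`), then for every site `x` the matrix
`M_x = Σ_{b∈box, b₋=x} U'_bU_b⁻¹ + Σ_{b∈box, b₊=x} U'_b⁻¹U_b` equals `(Re tr M_x / 2)·1` with `Re tr M_x ≥ 0`
(§2 on ✓`re_trace_su_mul_siteSum_eq_zero_of_orbitMin`; the sign from the competitor `g = −1` of ✓`reTr_oneSite_le_of_orbitMin`).
[cite: Balaban1987RG1, (0.14) p.254; Balaban1985Averaging, (156)–(163) p.42 (the regime this opens)] -/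
theorem siteSum_eq_smul_one_of_orbitMin (box : PBond P 0 → Prop) [DecidablePred box]
    (U U' : GaugeField P 0 (Matrix.specialUnitaryGroup (Fin 2) ℂ))
    (hmin : ∀ k : GaugeTransf P 0 (Matrix.specialUnitaryGroup (Fin 2) ℂ),
      (∑ b : PBond P 0, if box b then dist1 (U b * (U' b)⁻¹) ^ 2 else 0) ≤
        ∑ b : PBond P 0, if box b then dist1 (U b * (GaugeField.gaugeAct k U' b)⁻¹) ^ 2 else 0)
    (x : Site P 0) :
    ((∑ b : PBond P 0, if box b ∧ b.src = x then (((U' b : Matrix.specialUnitaryGroup (Fin 2) ℂ) : Matrix (Fin 2) (Fin 2) ℂ) * (((U b)⁻¹ : Matrix.specialUnitaryGroup (Fin 2) ℂ) : Matrix (Fin 2) (Fin 2) ℂ)) else 0) +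
        (∑ b : PBond P 0, if box b ∧ b.tgt = x then ((((U' b)⁻¹ : Matrix.specialUnitaryGroup (Fin 2) ℂ) : Matrix (Fin 2) (Fin 2) ℂ) * ((U b : Matrix.specialUnitaryGroup (Fin 2) ℂ) : Matrix (Fin 2) (Fin 2) ℂ)) else 0)) =
      (((((∑ b : PBond P 0, if box b ∧ b.src = x then (((U' b : Matrix.specialUnitaryGroup (Fin 2) ℂ) : Matrix (Fin 2) (Fin 2) ℂ) * (((U b)⁻¹ : Matrix.specialUnitaryGroup (Fin 2) ℂ) : Matrix (Fin 2) (Fin 2) ℂ)) else 0) +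
        (∑ b : PBond P 0, if box b ∧ b.tgt = x then ((((U' b)⁻¹ : Matrix.specialUnitaryGroup (Fin 2) ℂ) : Matrix (Fin 2) (Fin 2) ℂ) * ((U b : Matrix.specialUnitaryGroup (Fin 2) ℂ) : Matrix (Fin 2) (Fin 2) ℂ)) else 0)).trace).re / 2 : ℝ) : ℂ) • (1 : Matrix (Fin 2) (Fin 2) ℂ) ∧
    0 ≤ (((∑ b : PBond P 0, if box b ∧ b.src = x then (((U' b : Matrix.specialUnitaryGroup (Fin 2) ℂ) : Matrix (Fin 2) (Fin 2) ℂ) * (((U b)⁻¹ : Matrix.specialUnitaryGroup (Fin 2) ℂ) : Matrix (Fin 2) (Fin 2) ℂ)) else 0) +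
        (∑ b : PBond P 0, if box b ∧ b.tgt = x then ((((U' b)⁻¹ : Matrix.specialUnitaryGroup (Fin 2) ℂ) : Matrix (Fin 2) (Fin 2) ℂ) * ((U b : Matrix.specialUnitaryGroup (Fin 2) ℂ) : Matrix (Fin 2) (Fin 2) ℂ)) else 0)).trace).re := by
  refine ⟨?_, ?_⟩
  · -- `M_x ∈ ℍ`, then §2 with the Coulomb letter
    refine eq_smul_one_of_quat_of_forall_re_trace ?_ (fun X hX htr => re_trace_su_mul_siteSum_eq_zero_of_orbitMin box U U' hmin x hX htr)
    refine quat_add ?_ ?_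
    · refine quat_sum_ite _ _ _ fun b _ _ => ?_
      rw [← Submonoid.coe_mul]
      exact quat_coe_su2 _
    · refine quat_sum_ite _ _ _ fun b _ _ => ?_
      rw [← Submonoid.coe_mul]
      exact quat_coe_su2 _
  · -- the competitor `g = −1`
    have hneg : (-1 : Matrix (Fin 2) (Fin 2) ℂ) ∈ Matrix.specialUnitaryGroup (Fin 2) ℂ := by
      rw [Matrix.mem_specialUnitaryGroup_iff]
      refine ⟨?_, ?_⟩
      · rw [Matrix.mem_unitaryGroup_iff]
        simp
      · rw [Matrix.det_neg, Matrix.det_one, Fintype.card_fin]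
        norm_num
    have hg := reTr_oneSite_le_of_orbitMin box U U' hmin x ⟨-1, hneg⟩
    simp only [reTr_eq_half_re_trace, Submonoid.coe_mul, neg_one_mul, Matrix.trace_neg, Complex.neg_re] at hg
    rw [Matrix.trace_add, Matrix.trace_sum, Matrix.trace_sum, Complex.add_re, Complex.re_sum, Complex.re_sum]
    have h1 : ∀ (c : PBond P 0 → Prop) [DecidablePred c] (f : PBond P 0 → Matrix (Fin 2) (Fin 2) ℂ),
        (∑ b : PBond P 0, ((if c b then f b else 0).trace).re) = ∑ b : PBond P 0, if c b then ((f b).trace).re else 0 := by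
      intro c _ f
      exact Finset.sum_congr rfl fun b _ => by split_ifs <;> simp
    have h2 : ∀ (c : PBond P 0 → Prop) [DecidablePred c] (f : PBond P 0 → ℝ),
        (∑ b : PBond P 0, if c b then f b / 2 else 0) = (∑ b : PBond P 0, if c b then f b else 0) / 2 := by
      intro c _ f
      rw [Finset.sum_div]
      exact Finset.sum_congr rfl fun b _ => by split_ifs <;> simp
    have h3 : ∀ (c : PBond P 0 → Prop) [DecidablePred c] (f : PBond P 0 → ℝ),
        (∑ b : PBond P 0, if c b then -f b / 2 else 0) = -((∑ b : PBond P 0, if c b then f b else 0) / 2) := by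
      intro c _ f
      rw [Finset.sum_div, ← Finset.sum_neg_distrib]
      exact Finset.sum_congr rfl fun b _ => by split_ifs <;> simp [neg_div]
    rw [h1, h1]
    rw [h3, h3, h2, h2] at hg
    linarith

end Site

end Summit.QuantumFields.YangMills.Theorems.PoincareLipschitzOrbitMinScalar
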